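import Summits.RiemannHypothesis.RiemannHypothesis.Theorems.SuzukiStructureFunctionsWindowResolvent
import Summits.RiemannHypothesis.RiemannHypothesis.Theorems.SuzukiCleanRadiusDefs
import Literature.NumberTheory.LFunctions.SuzukiSingleOperatorKernelProofs

/-!
# SuzukiStructureFunctionsCleanOpen — Suzuki's (K5) is an OPEN condition in `t`: clean windows are stable, every clean
# compact range `[0,T]` extends to `[0,T+δ)`, `CleanUpTo θ T ⇒ CleanUpTo θ T'` with `T' > T` (column DBR; RH-FREE)

LINE 1 — LABEL: RH-FREE (ζ-free operator theory for ANY continuous kernel; for `K_θ` only its continuity [Su20] Thm 1.2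
is used; no zeros, no positivity); bears_on LADDER-RH B-D → B-P(P2): structure of the column's clean-window ranges (the
maximal clean range `[0,τ)` of (K5) is half-open; certified clean radii are never maximal). WHAT THIS IS NOT: not progress
toward RH; no new clean window is certified here; `∃θ ∀t clean` (RH-equivalent) is NOT claimed.

Source: M. Suzuki, J. Funct. Anal. 281 (2021) 109116 = arXiv:1606.05726 [Suzuki2021Hamiltonians], §3.1 (K5) («there exists
`0 < τ ≤ ∞` such that both `±1` are not eigenvalues of `𝖪[t]` for every `t < τ`»), Lemma 3.3 (Fredholm alternative); [Su20]
M. Suzuki, ASPM 84 (2020), Thm 1.2 (continuity of `K_θ`).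

Contents (seat rh-dbr-eng-5 g7; continuation of `…WindowResolvent`):
* `noUnitEigenvalue_of_isUnit`, **`noUnitEigenvalue_iff_isUnit`** — (K5) at `t` ⟺ `1 ± 𝖪[t]` are units on `L²(ℝ)`;
* **`eventually_noUnitEigenvalue`** — at a clean `t₀ ≥ 0`, all nearby `t ≥ 0` are clean (units are open, `t ↦ 𝖪[t]`
  norm-continuous);
* **`exists_clean_extension`** — a clean `[0,T]` extends to a clean `[0,T+δ)`;
* **`cleanUpTo_extend`** — for `K_θ` (`θ > 1`): `CleanUpTo θ T → ∃ T' > T, CleanUpTo θ T'`.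
-/

noncomputable section

-- D-0017: `Summit.<S>.<S>.…` is the designed namespace of a single-problem summit.
set_option linter.dupNamespace false

open MeasureTheory Set Filter Topology Function

namespace Summit.RiemannHypothesis.RiemannHypothesis.Theorems.SuzukiStructureFunctions

open Literature.Analysis.OperatorTheory Literature.NumberTheory.LFunctions
open Summit.RiemannHypothesis.RiemannHypothesis.Theorems.SuzukiCleanRadius (CleanUpTo)

variable {K : ℝ → ℝ} {t : ℝ}

/-! ## §20 Clean windows form an OPEN set in `t`; the maximal clean range `[0,τ)` is half-open

`NoUnitEigenvalue K t` (Suzuki's (K5) at time `t`) is EQUIVALENT to the invertibility of both `1 ± 𝖪[t]` on the fixed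
space `L²(ℝ)`; units form an open set and `t ↦ 𝖪[t]` is norm-continuous (§15), so the clean windows `t ≥ 0` form a
relatively open subset of `[0,∞)`: a clean compact range `[0,T]` always extends to `[0,T+δ)` — in particular for the
column's kernels `K_θ`, `CleanUpTo θ T ⇒ CleanUpTo θ T'` for some `T' > T`. -/

/-- RH-FREE. **Converse of `isUnit_one_add_smul_winOpL2`:** if `1 + 𝖪[t]` and `1 − 𝖪[t]` are units on `L²(ℝ)` then the
window is clean (`NoUnitEigenvalue K t`): an `L²(−t,t)` unit eigenfunction, extended by zero, would be annihilated by the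
corresponding unit. -/
theorem noUnitEigenvalue_of_isUnit (hK : Continuous K)
    (h1 : IsUnit (1 + (1 : ℝ) • winOpL2 K hK t)) (h2 : IsUnit (1 + (-1 : ℝ) • winOpL2 K hK t)) :
    NoUnitEigenvalue K t := by
  intro ε hε f hf heig
  set A := winOpL2 K hK t with hAdef
  have hA := winOpL2_spec hK t
  -- extend `f` by zero to `ℝ`
  have hfI : MemLp ((Ioo (-t) t).indicator f) 2 (volume : Measure ℝ) :=
    (memLp_indicator_iff_restrict measurableSet_Ioo).2 hf
  set ψ : Lp ℝ 2 (volume : Measure ℝ) := hfI.toLp _ with hψ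
  have hψ_ae : (ψ : ℝ → ℝ) =ᵐ[volume] (Ioo (-t) t).indicator f := MemLp.coeFn_toLp _
  -- `A ψ = ε ψ`
  have heig' : ∀ᵐ x ∂(volume : Measure ℝ), x ∈ Ioo (-t) t → ∫ y in Ioo (-t) t, K (x + y) * f y = ε * f x :=
    (ae_restrict_iff' measurableSet_Ioo).1 heig
  have hpts : ∀ᵐ x ∂(volume : Measure ℝ), x ≠ -t ∧ x ≠ t := by
    have e1 : ({-t}ᶜ : Set ℝ) ∈ ae (volume : Measure ℝ) := compl_mem_ae_iff.mpr (measure_singleton _)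
    have e2 : ({t}ᶜ : Set ℝ) ∈ ae (volume : Measure ℝ) := compl_mem_ae_iff.mpr (measure_singleton _)
    filter_upwards [e1, e2] with x hx1 hx2
    exact ⟨hx1, hx2⟩
  have hAψ : A ψ = ε • ψ := by
    apply Lp.ext
    filter_upwards [hA ψ, Lp.coeFn_smul ε ψ, hψ_ae, heig', hpts] with x e1 e2 e3 e4 e5
    rw [e1, e2, Pi.smul_apply, smul_eq_mul, e3]
    have hint : ∫ y, winKer K t x y * (ψ : ℝ → ℝ) y = ∫ y, winKer K t x y * (Ioo (-t) t).indicator f y :=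
      integral_congr_ae (by filter_upwards [hψ_ae] with y hy; rw [hy])
    rw [hint]
    by_cases hx : x ∈ Ioo (-t) t
    · rw [indicator_of_mem hx, integral_winKer_mul_eq_setIntegral K (Ioo_subset_Icc_self hx), ← e4 hx]
      exact setIntegral_congr_fun measurableSet_Ioo fun y hy => by rw [indicator_of_mem hy]
    · rw [indicator_of_notMem hx, mul_zero]
      have hxI : x ∉ Icc (-t) t := fun h => hx ⟨lt_of_le_of_ne h.1 (Ne.symm e5.1), lt_of_le_of_ne h.2 e5.2⟩
      exact integral_winKer_mul_eq_zero K hxI _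
  -- `(1 + (−ε)A) ψ = 0`, and `1 + (−ε)A` is a unit
  have hεsq : ε * ε = 1 := by rcases hε with rfl | rfl <;> norm_num
  have hunit : IsUnit (1 + (-ε) • A) := by
    rcases hε with rfl | rfl
    · simpa using h2
    · simpa using h1
  set U' : Lp ℝ 2 (volume : Measure ℝ) →L[ℝ] Lp ℝ 2 (volume : Measure ℝ) := 1 + (-ε) • A with hU'
  have hzero : U' ψ = 0 := by
    have e : U' ψ = ψ + (-ε) • A ψ := by simp [hU']
    rw [e, hAψ, smul_smul, show -ε * ε = -1 by linarith, neg_one_smul, add_neg_cancel]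
  have hψ0 : ψ = 0 := by
    have h : (Ring.inverse U' * U') ψ = Ring.inverse U' 0 := congrArg (fun v => Ring.inverse U' v) hzero
    rw [Ring.inverse_mul_cancel _ hunit, map_zero] at h
    simpa using h
  -- back to `f` on the window
  have hind : (Ioo (-t) t).indicator f =ᵐ[volume] (0 : ℝ → ℝ) := by
    have h0 : ((0 : Lp ℝ 2 (volume : Measure ℝ)) : ℝ → ℝ) =ᵐ[volume] 0 := Lp.coeFn_zero _ _ _
    rw [← hψ0] at h0
    exact hψ_ae.symm.trans h0
  rw [EventuallyEq, ae_restrict_iff' measurableSet_Ioo]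
  filter_upwards [hind] with x hx hxI
  rw [← indicator_of_mem hxI f, hx]

/-- RH-FREE. **(K5) at time `t` ⟺ `1 ± 𝖪[t]` are units on `L²(ℝ)`.** -/
theorem noUnitEigenvalue_iff_isUnit (hK : Continuous K) :
    NoUnitEigenvalue K t ↔ IsUnit (1 + (1 : ℝ) • winOpL2 K hK t) ∧ IsUnit (1 + (-1 : ℝ) • winOpL2 K hK t) :=
  ⟨fun h => ⟨isUnit_one_add_smul_winOpL2 hK (Or.inl rfl) h, isUnit_one_add_smul_winOpL2 hK (Or.inr rfl) h⟩,
    fun h => noUnitEigenvalue_of_isUnit hK h.1 h.2⟩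

/-- **RH-FREE · CLEAN WINDOWS ARE STABLE: the set of clean windows is relatively open in `[0,∞)`.** At a clean `t₀ ≥ 0`,
every nearby `t ≥ 0` is clean (units are open in the Banach algebra of bounded operators on `L²(ℝ)`; `t ↦ 𝖪[t]` is
norm-continuous). -/
theorem eventually_noUnitEigenvalue (hK : Continuous K) {t₀ : ℝ} (ht₀ : 0 ≤ t₀) (hN : NoUnitEigenvalue K t₀) :
    ∀ᶠ t in 𝓝[Ici 0] t₀, NoUnitEigenvalue K t := by
  have hc : ∀ ε : ℝ, ContinuousWithinAt (fun t : ℝ =>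
      (1 : Lp ℝ 2 (volume : Measure ℝ) →L[ℝ] Lp ℝ 2 (volume : Measure ℝ)) + ε • winOpL2 K hK t) (Ici 0) t₀ :=
    fun ε => ((continuousOn_winOpL2 hK t₀ ht₀).const_smul ε).const_add _ |>.congr (fun _ _ => rfl) rfl
  obtain ⟨h1, h2⟩ := (noUnitEigenvalue_iff_isUnit hK).1 hN
  have e1 : ∀ᶠ t in 𝓝[Ici 0] t₀, IsUnit ((1 : Lp ℝ 2 (volume : Measure ℝ) →L[ℝ] Lp ℝ 2 (volume : Measure ℝ)) +
      (1 : ℝ) • winOpL2 K hK t) := (hc 1) (Units.isOpen.mem_nhds h1)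
  have e2 : ∀ᶠ t in 𝓝[Ici 0] t₀, IsUnit ((1 : Lp ℝ 2 (volume : Measure ℝ) →L[ℝ] Lp ℝ 2 (volume : Measure ℝ)) +
      (-1 : ℝ) • winOpL2 K hK t) := (hc (-1)) (Units.isOpen.mem_nhds h2)
  filter_upwards [e1, e2] with t ht1 ht2
  exact noUnitEigenvalue_of_isUnit hK ht1 ht2

/-- **RH-FREE · a clean compact range extends:** if every window `0 ≤ t ≤ T` is clean (`T ≥ 0`), then for some `δ > 0`
every window `0 ≤ t < T + δ` is clean — the maximal clean range `[0,τ)` of (K5) is half-open. -/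
theorem exists_clean_extension (hK : Continuous K) {T : ℝ} (hT : 0 ≤ T)
    (hclean : ∀ t : ℝ, 0 ≤ t → t ≤ T → NoUnitEigenvalue K t) :
    ∃ δ : ℝ, 0 < δ ∧ ∀ t : ℝ, 0 ≤ t → t < T + δ → NoUnitEigenvalue K t := by
  have hev := (eventually_noUnitEigenvalue hK hT (hclean T hT le_rfl)).filter_mono
    (nhdsWithin_mono T (Ici_subset_Ici.2 hT))
  rw [(nhdsGE_basis_Ico T).eventually_iff] at hev
  obtain ⟨u, hu, hsub⟩ := hev
  refine ⟨u - T, by linarith [hu], fun t ht0 htu => ?_⟩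
  rcases le_or_gt t T with h | h
  · exact hclean t ht0 h
  · exact hsub ⟨h.le, by linarith⟩

/-- **RH-FREE · for Suzuki's single-operator kernels `K_θ` (`θ > 1`): `CleanUpTo θ T ⇒ CleanUpTo θ T'` for some
`T' > T`** (`T ≥ 0`) — the column's certified clean radii are never maximal; the true clean radius `τ_θ` is the first
unit-eigenvalue time and is not attained. -/
theorem cleanUpTo_extend {θ T : ℝ} (hθ : 1 < θ) (hT : 0 ≤ T) (h : CleanUpTo θ T) :
    ∃ T' : ℝ, T < T' ∧ CleanUpTo θ T' := by
  obtain ⟨δ, hδ, hc⟩ := exists_clean_extension (Suzuki2020_thm12_continuous hθ) hT h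
  exact ⟨T + δ / 2, by linarith, fun t ht0 ht => hc t ht0 (by linarith)⟩

end Summit.RiemannHypothesis.RiemannHypothesis.Theorems.SuzukiStructureFunctions

end
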